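import Mathlib
import Summits.MatrixMultiplication.MatrixMultiplication.Theorems.SnSubsetDichotomyNoThresholdSubsetTripleFreedman

/-!
# Freedman's lower tail for compensated sums of bounded adapted increments

Stub `freedman_compensated_lowerTail` for line `klr-graded-polynomial-method` of crux
`stmt-MatrixMultiplication-8302` (the pure-Mathlib probabilistic core of the Freedman split
`J = martingale part + compensator`). Let `Z_t` be real increments on a probability space with
`Z_t` measurable for `ℱ (t+1)` and `|Z_t| ≤ B`. Then the compensated sum
`Σ_{t<n} (Z_t − μ[Z_t | ℱ t])` has Freedman's lower tail with the predictable second moment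
`Σ_{t<n} μ[Z_t² | ℱ t]` as variance proxy: for every `x, v` and every `λ ≥ 0`,
`μ {Σ (Z_t − μ[Z_t | ℱ t]) ≤ −x ∧ Σ μ[Z_t² | ℱ t] ≤ v} ≤ exp (−λx + v (e^{2λB} − 1 − 2λB)/(2B)²)`
[Freedman 1975, Thm 1.6 / (4.1)–(4.3), applied to the negated martingale differences].

Proof: with `T_t = max (−B) (min B (μ[Z_t | ℱ t]))` the truncated conditional mean (equal to
`μ[Z_t | ℱ t]` a.e. by `ae_bdd_abs_condExp_of_ae_bdd_abs`, but bounded by `B` everywhere, which the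
pointwise hypothesis of `stub_freedman_exp` needs), `D_{t+1} = T_t − Z_t` (`D_0 = 0`) are
martingale differences adapted to `ℱ`, bounded by `2B`, with
`μ[D_{t+1}² | ℱ t] = Var[Z_t | ℱ t] ≤ μ[Z_t² | ℱ t]` a.e.
(`ProbabilityTheory.condVar_ae_le_condExp_sq`). Off a null set the event in question lies inside
the Freedman event `{x ≤ Σ D_{t+1} ∧ Σ μ[D_{t+1}² | ℱ t] ≤ v}`, whose measure `stub_freedman_exp`
(file `…TripleFreedman.lean`) bounds with `b = 2B`. The bookkeeping is that of
`stub_lyapunov_band_two` (file `…LyapunovBandTwo.lean`).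
-/

open MeasureTheory ProbabilityTheory
open scoped BigOperators

namespace Summit.MatrixMultiplication.MatrixMultiplication.Theorems

-- The private lemmas below are adapted from
-- Summits/MatrixMultiplication/MatrixMultiplication/Theorems/SnSubsetDichotomyNoThresholdSubsetTripleLyapunovBandTwo.lean
-- (`band2_*`), under new names.

set_option linter.dupNamespace false in
/-- Real-valued monotonicity of a finite measure along an a.e. inclusion: if `s ⊆ t` off a `μ`-null
set then `μ.real s ≤ μ.real t`. [folklore] -/
private theorem fcomp_measureReal_mono_ae {Ω : Type*} [MeasurableSpace Ω] {μ : Measure Ω}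
    [IsFiniteMeasure μ] {s t : Set Ω} (h : ∀ᵐ ω ∂μ, ω ∈ s → ω ∈ t) : μ.real s ≤ μ.real t := by
  -- adapted from `band2_measureReal_mono_ae` (…LyapunovBandTwo.lean)
  simp only [measureReal_def]
  exact ENNReal.toReal_mono (measure_ne_top _ _) (measure_mono_ae h)

set_option linter.dupNamespace false in
/-- The truncation at level `B ≥ 0` is bounded by `B`: `|max (-B) (min B x)| ≤ B`. [folklore] -/
private theorem fcomp_abs_trunc_le {B : ℝ} (hB : 0 ≤ B) (x : ℝ) : |max (-B) (min B x)| ≤ B :=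
  -- adapted from `band2_abs_trunc_le` (…LyapunovBandTwo.lean)
  abs_le.2 ⟨le_max_left _ _, max_le (by linarith) (min_le_left _ _)⟩

set_option linter.dupNamespace false in
/-- The truncation at level `B` does nothing to `x` when `|x| ≤ B`. [folklore] -/
private theorem fcomp_trunc_eq_self {B x : ℝ} (h : |x| ≤ B) : max (-B) (min B x) = x := by
  -- adapted from `band2_trunc_eq_self` (…LyapunovBandTwo.lean)
  obtain ⟨h1, h2⟩ := abs_le.1 h
  rw [min_eq_right h2, max_eq_right h1]

set_option linter.dupNamespace false in
/-- The truncation of a strongly measurable real function is strongly measurable (composition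
with the continuous map `x ↦ max (-B) (min B x)`). [folklore] -/
private theorem fcomp_stronglyMeasurable_trunc {Ω : Type*} {m : MeasurableSpace Ω} (B : ℝ)
    {f : Ω → ℝ} (hf : StronglyMeasurable[m] f) :
    StronglyMeasurable[m] (fun ω => max (-B) (min B (f ω))) := by
  -- adapted from `band2_stronglyMeasurable_trunc` (…LyapunovBandTwo.lean)
  have hg : Continuous fun x : ℝ => max (-B) (min B x) :=
    continuous_const.max (continuous_const.min continuous_id)
  exact hg.comp_stronglyMeasurable hf

set_option linter.dupNamespace false in
/-- The conditional expectation of a function bounded by `B` is bounded by `B` a.e.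
(`ae_bdd_abs_condExp_of_ae_bdd_abs`), hence its truncation at level `B` equals it a.e.
[folklore] -/
private theorem fcomp_trunc_condExp_ae_eq {Ω : Type*} {m mΩ : MeasurableSpace Ω} {μ : Measure Ω}
    {X : Ω → ℝ} {B : ℝ} (hXbdd : ∀ ω, |X ω| ≤ B) :
    ∀ᵐ ω ∂μ, max (-B) (min B ((μ[X | m]) ω)) = (μ[X | m]) ω := by
  -- adapted from `band2_trunc_condExp_ae_eq` (…LyapunovBandTwo.lean)
  filter_upwards [ae_bdd_abs_condExp_of_ae_bdd_abs (m := m) (ae_of_all μ hXbdd)] with ω hω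
  exact fcomp_trunc_eq_self hω

set_option linter.dupNamespace false in
/-- **Centering (negated form).** If `Y` is an `m`-measurable integrable version of `μ[X | m]`
(equal to it a.e.), then `Y - X` is conditionally centred: `μ[Y - X | m] = Y - μ[X | m] = 0` a.e.
[folklore] -/
private theorem fcomp_condExp_sub_ae_eq_zero {Ω : Type*} {m mΩ : MeasurableSpace Ω}
    {μ : Measure Ω} [IsFiniteMeasure μ] (hm : m ≤ mΩ) {X Y : Ω → ℝ} (hX : Integrable X μ)
    (hYm : StronglyMeasurable[m] Y) (hY : Integrable Y μ)
    (hYE : ∀ᵐ ω ∂μ, Y ω = (μ[X | m]) ω) :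
    μ[fun ω => Y ω - X ω | m] =ᵐ[μ] 0 := by
  -- adapted from `band2_condExp_sub_ae_eq_zero` (…LyapunovBandTwo.lean), with `X` and `Y` swapped
  have hsub : μ[Y - X | m] =ᵐ[μ] μ[Y | m] - μ[X | m] := condExp_sub hY hX m
  have hYY : μ[Y | m] = Y := condExp_of_stronglyMeasurable hm hYm hY
  change μ[Y - X | m] =ᵐ[μ] 0
  filter_upwards [hsub, hYE] with ω h1 h2
  rw [h1, Pi.sub_apply, hYY, h2, Pi.zero_apply, sub_self]

set_option linter.dupNamespace false in
/-- **Conditional variance (negated form).** If `Y = μ[X | m]` a.e. and `X ∈ L²`, then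
`μ[(Y - X)² | m] = μ[(X - Y)² | m] = Var[X | m] ≤ μ[X² | m]` a.e.
(`ProbabilityTheory.condVar_ae_le_condExp_sq`). [folklore] -/
private theorem fcomp_condExp_sq_sub_ae_le {Ω : Type*} {m mΩ : MeasurableSpace Ω} {μ : Measure Ω}
    [IsFiniteMeasure μ] (hm : m ≤ mΩ) {X Y : Ω → ℝ} (hX : MemLp X 2 μ)
    (hYE : ∀ᵐ ω ∂μ, Y ω = (μ[X | m]) ω) :
    μ[fun ω => (Y ω - X ω) ^ 2 | m] ≤ᵐ[μ] μ[fun ω => X ω ^ 2 | m] := by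
  -- adapted from `band2_condExp_sq_sub_ae_le` (…LyapunovBandTwo.lean), with the square symmetrised
  have hae : (fun ω => (Y ω - X ω) ^ 2) =ᵐ[μ] (X - μ[X | m]) ^ 2 := by
    filter_upwards [hYE] with ω hω
    rw [Pi.pow_apply, Pi.sub_apply, hω]
    ring
  have h1 : μ[fun ω => (Y ω - X ω) ^ 2 | m] =ᵐ[μ] Var[X; μ | m] := condExp_congr_ae hae
  have h2 : Var[X; μ | m] ≤ᵐ[μ] μ[X ^ 2 | m] := condVar_ae_le_condExp_sq hm hX
  exact h1.trans_le h2

/- The registered signature spells Mathlib's scoped notation `StronglyMeasurable[m] f` with its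
namespace qualifier, `MeasureTheory.StronglyMeasurable[m] f`, which the Lean tokenizer does not
accept as-is (`MeasureTheory.StronglyMeasurable` lexes as one identifier followed by `[`). This
local, purely syntactic shim registers that spelling with the SAME expansion as Mathlib's
`StronglyMeasurable[m] := @MeasureTheory.StronglyMeasurable _ _ _ m`
(Mathlib/MeasureTheory/Function/StronglyMeasurable/Basic.lean), so that the theorem below can be
stated verbatim as registered; its elaborated type is the binder form
`(h_meas : ∀ t, StronglyMeasurable[ℱ (t + 1)] (Z t)) → …` used by the line skeleton. -/
local notation "MeasureTheory.StronglyMeasurable[" m "]" => @MeasureTheory.StronglyMeasurable _ _ _ m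

set_option linter.dupNamespace false in
/-- **Freedman's lower tail for compensated bounded adapted increments.** On a probability space
with filtration `ℱ`, let `Z_t` be `ℱ (t+1)`-strongly measurable with `|Z_t| ≤ B` (`B > 0`). Then
for every `n`, every `x, v` and every `λ ≥ 0`,
`μ {Σ_{t<n} (Z_t − μ[Z_t | ℱ t]) ≤ −x ∧ Σ_{t<n} μ[Z_t² | ℱ t] ≤ v}
  ≤ exp (−λx + v (e^{λ(2B)} − 1 − λ(2B))/(2B)²)`.
Proof: `D_{t+1} = T_t − Z_t` (`T_t` the truncation at level `B` of `μ[Z_t | ℱ t]`, a.e. equal to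
it; `D_0 = 0`) are martingale differences bounded by `2B` with
`μ[D_{t+1}² | ℱ t] = Var[Z_t | ℱ t] ≤ μ[Z_t² | ℱ t]` a.e.; off a null set the event lies in the
Freedman event `{x ≤ Σ D_{t+1} ∧ Σ μ[D_{t+1}² | ℱ t] ≤ v}`, bounded by `stub_freedman_exp` with
`b = 2B`. [Freedman 1975, Thm 1.6] -/
theorem freedman_compensated_lowerTail :
    ∀ {Ω : Type*} {mΩ : MeasurableSpace Ω} {μ : MeasureTheory.Measure Ω}
    [MeasureTheory.IsProbabilityMeasure μ] (ℱ : MeasureTheory.Filtration ℕ mΩ) (Z : ℕ → Ω → ℝ)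
    (B : ℝ), 0 < B → (∀ t, MeasureTheory.StronglyMeasurable[ℱ (t + 1)] (Z t)) →
    (∀ t ω, |Z t ω| ≤ B) → ∀ (n : ℕ) (x v lam : ℝ), 0 ≤ lam →
    μ.real {ω | ∑ t ∈ Finset.range n, (Z t ω - (μ[Z t | ℱ t]) ω) ≤ -x ∧
    ∑ t ∈ Finset.range n, (μ[fun ω' => Z t ω' ^ 2 | ℱ t]) ω ≤ v} ≤
    Real.exp (-(lam * x) + v * ((Real.exp (lam * (2 * B)) - 1 - lam * (2 * B)) / (2 * B) ^ 2)) := by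
  intro Ω mΩ μ _ ℱ Z B hB h_meas h_bdd n x v lam hlam
  have hB0 : 0 ≤ B := hB.le
  have h2B : 0 < 2 * B := by positivity
  -- the increments `Z t`: measurability (w.r.t. `mΩ`), integrability, square integrability
  have hZae : ∀ t, AEStronglyMeasurable (Z t) μ := fun t =>
    ((h_meas t).mono (ℱ.le (t + 1))).aestronglyMeasurable
  have hZint : ∀ t, Integrable (Z t) μ := fun t =>
    Integrable.of_bound (hZae t) B (ae_of_all _ fun ω => by
      rw [Real.norm_eq_abs]; exact h_bdd t ω)
  have hZL2 : ∀ t, MemLp (Z t) 2 μ := fun t =>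
    MemLp.of_bound (hZae t) B (ae_of_all _ fun ω => by
      rw [Real.norm_eq_abs]; exact h_bdd t ω)
  -- the truncated conditional means `T_t` of the increments
  obtain ⟨T, hT⟩ : ∃ T : ℕ → Ω → ℝ, ∀ t, T t = fun ω =>
      max (-B) (min B ((μ[Z t | ℱ t]) ω)) :=
    ⟨_, fun _ => rfl⟩
  have hTm : ∀ t, StronglyMeasurable[ℱ t] (T t) := fun t => by
    rw [hT t]
    exact fcomp_stronglyMeasurable_trunc _ stronglyMeasurable_condExp
  have hTbdd : ∀ t ω, |T t ω| ≤ B := fun t ω => by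
    rw [hT t]
    exact fcomp_abs_trunc_le hB0 _
  have hTint : ∀ t, Integrable (T t) μ := fun t =>
    Integrable.of_bound ((hTm t).mono (ℱ.le t)).aestronglyMeasurable B
      (ae_of_all _ fun ω => by rw [Real.norm_eq_abs]; exact hTbdd t ω)
  have hTE : ∀ t, ∀ᵐ ω ∂μ, T t ω = (μ[Z t | ℱ t]) ω := fun t => by
    rw [hT t]
    exact fcomp_trunc_condExp_ae_eq (h_bdd t)
  -- the (negated) martingale differences `D (t+1) = T_t - Z_t`, `D 0 = 0`
  obtain ⟨D, hD0, hDsucc⟩ : ∃ D : ℕ → Ω → ℝ, D 0 = (fun _ => 0) ∧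
      ∀ t, D (t + 1) = fun ω => T t ω - Z t ω :=
    ⟨fun i => match i with
      | 0 => fun _ => 0
      | t + 1 => fun ω => T t ω - Z t ω, rfl, fun _ => rfl⟩
  have hDmeas : ∀ i, StronglyMeasurable[ℱ i] (D i) := by
    intro i
    cases i with
    | zero => rw [hD0]; exact stronglyMeasurable_const
    | succ t => rw [hDsucc]; exact ((hTm t).mono (ℱ.mono (Nat.le_succ t))).sub (h_meas t)
  have hDbdd : ∀ i ω, |D i ω| ≤ 2 * B := by
    intro i ω
    cases i with
    | zero =>
      rw [hD0]
      show |(0 : ℝ)| ≤ 2 * B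
      rw [abs_zero]
      exact h2B.le
    | succ t =>
      rw [hDsucc]
      show |T t ω - Z t ω| ≤ 2 * B
      have h1 := abs_le.1 (h_bdd t ω)
      have h2 := abs_le.1 (hTbdd t ω)
      exact abs_le.2 ⟨by linarith [h1.2, h2.1], by linarith [h1.1, h2.2]⟩
  have hDmds : ∀ i, μ[D (i + 1) | ℱ i] =ᵐ[μ] 0 := fun t => by
    rw [hDsucc]
    exact fcomp_condExp_sub_ae_eq_zero (ℱ.le t) (hZint t) (hTm t) (hTint t) (hTE t)
  -- Freedman's inequality for `D` with increment bound `2B`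
  have hF := stub_freedman_exp ℱ D (2 * B) h2B hDmeas hDbdd hDmds n x v lam hlam
  refine le_trans (fcomp_measureReal_mono_ae ?_) hF
  -- the a.e. facts, simultaneously for all `t`
  have hTE' : ∀ᵐ ω ∂μ, ∀ t, T t ω = (μ[Z t | ℱ t]) ω := ae_all_iff.2 hTE
  have hV : ∀ᵐ ω ∂μ, ∀ t, (μ[fun ω' => D (t + 1) ω' ^ 2 | ℱ t]) ω ≤
      (μ[fun ω' => Z t ω' ^ 2 | ℱ t]) ω := by
    refine ae_all_iff.2 fun t => ?_
    have h := fcomp_condExp_sq_sub_ae_le (ℱ.le t) (hZL2 t) (hTE t)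
    rw [hDsucc]
    exact h
  filter_upwards [hTE', hV] with ω hTω hVω hev
  obtain ⟨hSx, hQv⟩ := hev
  have hDω : ∀ i, D (i + 1) ω = (μ[Z i | ℱ i]) ω - Z i ω := by
    intro i
    rw [hDsucc, ← hTω i]
  refine ⟨?_, ?_⟩
  · -- `x ≤ Σ D (i+1) = -Σ (Z i - μ[Z i | ℱ i])`
    have hsum : ∑ i ∈ Finset.range n, D (i + 1) ω =
        -∑ i ∈ Finset.range n, (Z i ω - (μ[Z i | ℱ i]) ω) := by
      rw [← Finset.sum_neg_distrib]
      exact Finset.sum_congr rfl fun i _ => by rw [hDω i, neg_sub]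
    rw [hsum]
    linarith
  · -- `Σ μ[D (i+1)² | ℱ i] ≤ Σ μ[Z i² | ℱ i] ≤ v`
    calc ∑ i ∈ Finset.range n, (μ[fun ω' => D (i + 1) ω' ^ 2 | ℱ i]) ω
        ≤ ∑ i ∈ Finset.range n, (μ[fun ω' => Z i ω' ^ 2 | ℱ i]) ω :=
          Finset.sum_le_sum fun i _ => hVω i
      _ ≤ v := hQv

end Summit.MatrixMultiplication.MatrixMultiplication.Theorems
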